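import Summits.CriticalPhenomena.PercolationContinuityZ3.Theorems.PercNearOneGluingNoHeavyRsw3VolumeHyperscaling
import HarnessLib

/-!
# RSW3 lane (P2, gen 19): the VOLUME of the critical cluster — the sharp upper tail `P(|C(0) ∩ Λ(n)| ≥ K|Λ(n)|π(n)) ≤ (C/K)·π(n)`
# and the two-sided conditional tightness of `|C(0) ∩ Λ(n)| / (|Λ(n)|π(n))` given the arm, under (A2)□

builds on p205010 (kernel theorem, internal audit signed; external expert review pending) — NOT used in this file.

Cell `prim-rsw3`, prover seat `prim-rsw3-p2` (gen 19), memo `run/shared/lean/prim/rsw3/P2-RSWLITE.md` §26.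
Support file (`--supports stmt-CriticalPhenomena-4575`); no definitions, no named facts, no sorries.

Complement to `…Rsw3VolumeFatClusters` / `…Rsw3VolumeHyperscaling`: the volume upper tail with the correct `1/K` dependence (Markov with
the upper hyperscaling inequality; no arm term), and the resulting conditional statement.  `V_n(ω) = #{z ∈ Λ(n) : 0 ↔ z}`,
`s(n) = (2n+1)^d π_{p_c}(n)`.

* `real_volume_ge_le_div_of_ratio` (every `p` with (R1), `π_p(1) > 0`): `P_p( λ s_p(n) ≤ V_n ) ≤ (C₂/λ)·π_p(n)`;
* `exists_real_volume_ge_le_div_of_setToSetQuasiMultAspectAt` (`p_c(ℤ^d)`, (A2)□): `∃ C > 0, ∀ λ > 0, ∀ n ≥ 1, P( λ s(n) ≤ V_n ) ≤ (C/λ)·π(n)`;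
* **`exists_real_volume_cond_two_sided_of_setToSetQuasiMultAspectAt`**: `∃ λ₀, c, C > 0, ∀ n ≥ 1:
  c·π(⌊n/2⌋) ≤ P( λ₀ s(n) ≤ V_n ∧ 0 ↔ ∂ⁱⁿΛ(⌊n/2⌋) )` and `∀ K > 0: P( K s(n) ≤ V_n ∧ 0 ↔ ∂ⁱⁿΛ(⌊n/2⌋) ) ≤ (C/K)·π(⌊n/2⌋)` — conditionally on the arm to
  `∂ⁱⁿΛ(⌊n/2⌋)` the law of `V_n / s(n)` is bounded above in probability (tail `≤ C/K`) and charges `[λ₀, ∞)` with probability `≥ c`: the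
  pre-limit form of Kesten's 'the IIC has volume `≍ n^d π(n)` in `Λ(n)`' (Kesten 1986, Thm. (8), planar), upper half and positive-probability
  lower half, under the single LANE-4 input in every dimension.

References: H. Kesten, PTRF 73 (1986), Thm. (8) [Kesten1986]; C. Borgs, J. Chayes, H. Kesten, J. Spencer, Random Structures Algorithms 15
(1999) [BorgsChayesKestenSpencer1999]; D. Basu, A. Sapozhnikov, ECP 22 (2017) §1 (A2) [BasuSapozhnikov2017ECP]. [folklore]
-/

noncomputable section

namespace Summit.CriticalPhenomena.PercolationContinuityZ3.Theorems

namespace Rsw3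

open MeasureTheory Literature.Probability.LatticeModels Literature.Probability.Percolation
open SurfaceTension Crossing SimpleGraph

variable {d : ℕ}

open Classical in
/-- **Sharp volume upper tail** (every `p` satisfying (R1) with `π_p(1) > 0`; `d ≥ 1`): for `λ > 0` and `n ≥ 1`,
`P_p( λ·(2n+1)^d·π_p(n) ≤ #{z ∈ Λ(n) : 0 ↔ z} ) ≤ (C₂/λ)·π_p(n)` — Markov with `E #{z ∈ Λ(n) : 0 ↔ z} = Σ_{Λ(n)} τ ≤ C₂ n^d π_p(n)²`.
[cite: BorgsChayesKestenSpencer1999, §1 (hyperscaling relations)] -/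
theorem real_volume_ge_le_div_of_ratio (hd : 1 ≤ d) (p : unitInterval) {A : ℝ} (hA : 0 ≤ A)
    (hR1 : ∀ j n : ℕ, 1 ≤ j → j ≤ n →
      oneArmProb d p j ^ 2 * ((j : ℝ) / (16 * n)) ^ (d - 1) ≤ A * oneArmProb d p n ^ 2)
    (hπ1 : 0 < oneArmProb d p 1) (hπpos : ∀ k : ℕ, 0 < oneArmProb d p k)
    {lam : ℝ} (hlam : 0 < lam) {n : ℕ} (hn : 1 ≤ n) :
    (bondPercolation (zdGraph d) p).real
        {ω | lam * ((2 * (n : ℝ) + 1) ^ d * oneArmProb d p n) ≤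
          ((((box d n).filter fun z => ω ∈ (openConn (0 : Site d) z : Set (BondConfig (Site d)))).card : ℕ) : ℝ)} ≤
      (2 * d * A * (192 : ℝ) ^ (d - 1) + (5 : ℝ) ^ d * (A * (16 : ℝ) ^ (d - 1) / oneArmProb d p 1 ^ 2)) / lam *
        oneArmProb d p n := by
  classical
  set μ := bondPercolation (zdGraph d) p with hμ
  set C₂ : ℝ := 2 * d * A * (192 : ℝ) ^ (d - 1) + (5 : ℝ) ^ d * (A * (16 : ℝ) ^ (d - 1) / oneArmProb d p 1 ^ 2) with hC₂
  have hd0 : (0 : ℝ) < d := by exact_mod_cast (by omega : 0 < d)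
  have hC₂0 : 0 ≤ C₂ :=
    add_nonneg (by positivity) (mul_nonneg (by positivity) (div_nonneg (by positivity) (sq_nonneg _)))
  have hn0 : (0 : ℝ) < n := by exact_mod_cast hn
  have hπn := hπpos n
  set t : ℝ := lam * ((2 * (n : ℝ) + 1) ^ d * oneArmProb d p n) with ht
  have htpos : 0 < t := mul_pos hlam (mul_pos (by positivity) hπn)
  have hMarkov := real_card_filter_openConn_ge_le_sum_div μ n htpos
  have hsum : ∑ z ∈ box d n, μ.real (openConn (0 : Site d) z) ≤ C₂ * (n : ℝ) ^ d * oneArmProb d p n ^ 2 := by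
    have h := sum_tau_le_of_ratio hd p hA hR1 hπ1 hn
    rw [hC₂]
    refine le_trans (le_of_eq (Finset.sum_congr rfl fun z _ => ?_)) h
    rw [hμ, tau_def]
  have hnd : (n : ℝ) ^ d ≤ (2 * (n : ℝ) + 1) ^ d := pow_le_pow_left₀ hn0.le (by linarith) d
  calc μ.real {ω | t ≤ ((((box d n).filter fun z => ω ∈ (openConn (0 : Site d) z : Set (BondConfig (Site d)))).card : ℕ) : ℝ)}
      ≤ (∑ z ∈ box d n, μ.real (openConn (0 : Site d) z)) / t := hMarkov
    _ ≤ C₂ * (n : ℝ) ^ d * oneArmProb d p n ^ 2 / t := div_le_div_of_nonneg_right hsum htpos.le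
    _ ≤ C₂ * (2 * (n : ℝ) + 1) ^ d * oneArmProb d p n ^ 2 / t :=
        div_le_div_of_nonneg_right (mul_le_mul_of_nonneg_right (mul_le_mul_of_nonneg_left hnd hC₂0) (sq_nonneg _)) htpos.le
    _ = C₂ / lam * oneArmProb d p n := by
        rw [ht]; field_simp

open Classical in
/-- **Sharp volume upper tail under (A2)□** (`p_c(ℤ^d)`, `d ≥ 2`, `2 ≤ s ≤ L`, `ϰ > 0`): `∃ C > 0, ∀ λ > 0, ∀ n ≥ 1,
P_{p_c}( λ·(2n+1)^d·π_{p_c}(n) ≤ #{z ∈ Λ(n) : 0 ↔ z} ) ≤ (C/λ)·π_{p_c}(n)`. [cite: BorgsChayesKestenSpencer1999, §1 (hyperscaling relations)] [cite: BasuSapozhnikov2017ECP, §1 assumption (A2)] -/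
theorem exists_real_volume_ge_le_div_of_setToSetQuasiMultAspectAt (hd : 2 ≤ d) {s L : ℕ} (hs : 2 ≤ s) (hsL : s ≤ L) {ϰ : ℝ}
    (hϰ : 0 < ϰ) (h : SetToSetQuasiMultAspectAt d (criticalProbI d) s L ϰ) :
    ∃ C : ℝ, 0 < C ∧ ∀ lam : ℝ, 0 < lam → ∀ n : ℕ, 1 ≤ n →
      (bondPercolation (zdGraph d) (criticalProbI d)).real
          {ω | lam * ((2 * (n : ℝ) + 1) ^ d * oneArmProb d (criticalProbI d) n) ≤
            ((((box d n).filter fun z => ω ∈ (openConn (0 : Site d) z : Set (BondConfig (Site d)))).card : ℕ) : ℝ)} ≤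
        C / lam * oneArmProb d (criticalProbI d) n := by
  have hd1 : 1 ≤ d := by omega
  obtain ⟨A, hA, hR1⟩ := exists_sq_oneArmProb_ratio_of_setToSetQuasiMultAspectAt hd hs hsL hϰ h
  set pc : unitInterval := criticalProbI d with hpcdef
  have hpc : 0 < (pc : ℝ) := by rw [hpcdef, coe_criticalProbI]; exact criticalProb_zd_pos d hd1
  have hπpos : ∀ k : ℕ, 0 < oneArmProb d pc k := fun k =>
    (pow_pos hpc k).trans_le (DKT20.pow_le_real_siteToBoundary hd1 pc k)
  have hd0 : (0 : ℝ) < d := by exact_mod_cast (by omega : 0 < d)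
  refine ⟨2 * d * A * (192 : ℝ) ^ (d - 1) + (5 : ℝ) ^ d * (A * (16 : ℝ) ^ (d - 1) / oneArmProb d pc 1 ^ 2),
    add_pos_of_pos_of_nonneg (by positivity) (mul_nonneg (by positivity) (div_nonneg (by positivity) (sq_nonneg _))),
    fun lam hlam n hn => ?_⟩
  exact real_volume_ge_le_div_of_ratio hd1 pc hA.le hR1 (hπpos 1) hπpos hlam hn

open Classical in
/-- **Two-sided conditional tightness of the volume given the arm, under (A2)□** (`p_c(ℤ^d)`, `d ≥ 2`, `2 ≤ s ≤ L`, `ϰ > 0`):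
`∃ λ₀, c, C > 0` such that for all `n ≥ 1`, with `V_n = #{z ∈ Λ(n) : 0 ↔ z}`, `s(n) = (2n+1)^d π_{p_c}(n)` and the arm event
`A = {0 ↔ ∂ⁱⁿΛ(⌊n/2⌋)}`:  `c·P(A) ≤ P( λ₀ s(n) ≤ V_n ∧ A )` and, for every `K > 0`, `P( K s(n) ≤ V_n ∧ A ) ≤ (C/K)·P(A)`.
Conditionally on the arm, `V_n/s(n)` is bounded above in probability (tail `≤ C/K`) and is `≥ λ₀` with probability `≥ c` — the
pre-limit volume picture of the incipient infinite cluster (Kesten 1986 Thm. (8) in the plane).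
[cite: Kesten1986, Thm. (8)] [cite: BasuSapozhnikov2017ECP, §1 assumption (A2)] -/
theorem exists_real_volume_cond_two_sided_of_setToSetQuasiMultAspectAt (hd : 2 ≤ d) {s L : ℕ} (hs : 2 ≤ s) (hsL : s ≤ L)
    {ϰ : ℝ} (hϰ : 0 < ϰ) (h : SetToSetQuasiMultAspectAt d (criticalProbI d) s L ϰ) :
    ∃ lam c C : ℝ, 0 < lam ∧ 0 < c ∧ 0 < C ∧ ∀ n : ℕ, 1 ≤ n →
      c * oneArmProb d (criticalProbI d) (n / 2) ≤ (bondPercolation (zdGraph d) (criticalProbI d)).real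
        ({ω | lam * ((2 * (n : ℝ) + 1) ^ d * oneArmProb d (criticalProbI d) n) ≤
            ((((box d n).filter fun z => ω ∈ (openConn (0 : Site d) z : Set (BondConfig (Site d)))).card : ℕ) : ℝ)} ∩
          siteToBoundary d (n / 2)) ∧
      ∀ K : ℝ, 0 < K → (bondPercolation (zdGraph d) (criticalProbI d)).real
        ({ω | K * ((2 * (n : ℝ) + 1) ^ d * oneArmProb d (criticalProbI d) n) ≤
            ((((box d n).filter fun z => ω ∈ (openConn (0 : Site d) z : Set (BondConfig (Site d)))).card : ℕ) : ℝ)} ∩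
          siteToBoundary d (n / 2)) ≤ C / K * oneArmProb d (criticalProbI d) (n / 2) := by
  obtain ⟨lam, c, hlam, hc, hlow⟩ := exists_le_real_volume_ge_cond_of_setToSetQuasiMultAspectAt hd hs hsL hϰ h
  obtain ⟨C, hC, hup⟩ := exists_real_volume_ge_le_div_of_setToSetQuasiMultAspectAt hd hs hsL hϰ h
  refine ⟨lam, c, C, hlam, hc, hC, fun n hn => ⟨hlow n hn, fun K hK => ?_⟩⟩
  have hmono : oneArmProb d (criticalProbI d) n ≤ oneArmProb d (criticalProbI d) (n / 2) :=
    DCT16.real_siteToBoundary_antitone _ (Nat.div_le_self n 2)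
  calc (bondPercolation (zdGraph d) (criticalProbI d)).real
        ({ω | K * ((2 * (n : ℝ) + 1) ^ d * oneArmProb d (criticalProbI d) n) ≤
            ((((box d n).filter fun z => ω ∈ (openConn (0 : Site d) z : Set (BondConfig (Site d)))).card : ℕ) : ℝ)} ∩
          siteToBoundary d (n / 2))
      ≤ (bondPercolation (zdGraph d) (criticalProbI d)).real
        {ω | K * ((2 * (n : ℝ) + 1) ^ d * oneArmProb d (criticalProbI d) n) ≤
            ((((box d n).filter fun z => ω ∈ (openConn (0 : Site d) z : Set (BondConfig (Site d)))).card : ℕ) : ℝ)} :=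
        measureReal_mono Set.inter_subset_left (measure_ne_top _ _)
    _ ≤ C / K * oneArmProb d (criticalProbI d) n := hup K hK n hn
    _ ≤ C / K * oneArmProb d (criticalProbI d) (n / 2) := mul_le_mul_of_nonneg_left hmono (by positivity)

end Rsw3

end Summit.CriticalPhenomena.PercolationContinuityZ3.Theorems
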